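import Mathlib.Analysis.SpecialFunctions.Gamma.Beta
import Mathlib.Analysis.Complex.Trigonometric
import Mathlib.Analysis.SpecialFunctions.ImproperIntegrals
import Mathlib.MeasureTheory.Integral.IntegralEqImproper
import Literature.Analysis.FunctionSpaces.UniformRandomWalkDensity
import Literature.Analysis.FunctionSpaces.BesselJProofs
import Literature.Probability.RandomPlanarGeometry.EllipticKBasic
import HarnessLib

/-!
# Borwein–Straub–Wan–Zudilin `p₄(1)`: proved reductions between the printed forms

Companion (proofs only, no new named facts) to `UniformRandomWalkDensity.lean`.

## What is proved here

* `BorweinStraubWanZudilin2012_eq_5_2_iff_thm9` : eq. (5.2) of the source,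
  `p₄(1) = (√5/40) Γ(1/15)Γ(2/15)Γ(4/15)Γ(8/15)/π⁴` — written out as this explicit equation about
  `pearsonDensityFourAtOne`; it is no longer a separate named fact (review-split 2026-08-15: it
  was proved equivalent to Theorem 9, so it is merged into the fact
  `BorweinStraubWanZudilin2012_thm9`) — is equivalent to Theorem 9: the step "(eq:r50cs) may be
  simplified to (5.2)" (p. 10 of arXiv:1103.2995), which needs only `Γ(s)Γ(1-s) = π / sin(πs)`
  and `sin(π/15) sin(2π/15) sin(4π/15) sin(8π/15) = 1/16`; the identity of the two right-hand
  sides is proved upstream in `UniformRandomWalkDensity.lean` (`prod_sin_pi_div_fifteen`,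
  `prod_Gamma_fifteenths`, `BorweinStraubWanZudilin2012_thm9_rhs_eq_eq_5_2_rhs`) and used here in
  the direction needed below.
* The printed `K₁₅` form of `p₄(1)` — the full chain `r_{5,0} = (√5/40)G/π⁴ = (3√5/π³)((√5-1)/2)K₁₅²`
  of the display (5.2)–(5.3), read with the 15th singular modulus typed by its defining property
  `0 < k < 1`, `K′(k) = √15 K(k)` — is treated here through its EXPLICIT statement
  `∃ k, 0 < k < 1 ∧ K(1-k²) = √15 K(k²) ∧ pearsonDensityFourAtOne = (3√5/π³)((√5-1)/2) K(k²)²`,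
  independently of how the named fact `BorweinStraubWanZudilin2012_eq_5_3` of the statement file
  is cut (review-split 2026-08-15: that fact is re-cut to the second equality sign of the display,
  `(√5/40)G/π⁴ = (3√5/π³)((√5-1)/2)K₁₅²`, so that it no longer re-contains Theorem 9):
  `pearsonDensityFourAtOne_eq_K15_iff_of_eq_5_2` — GIVEN (5.2), the `K₁₅` form of `p₄(1)` holds
  iff some modulus `0 < k < 1` with `K′(k) = √15 K(k)` has
  `K(k)² = (1 + √5) Γ(1/15)Γ(2/15)Γ(4/15)Γ(8/15) / (240 π)` — the Borwein–Zucker [bz92] /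
  Borwein–Borwein singular-value evaluation of `K₁₅` which the source invokes ("Using [bz92]") to
  pass from (5.2) to (5.3). That evaluation (Chowla–Selberg for discriminant `-15`) is NOT in the
  tree; the lemma records exactly what separates the two printed forms (pure algebra:
  `(√5/40) G/π⁴ = (3√5/π³)((√5-1)/2) K² ⟺ K² = (1+√5) G/(240π)`).
* `singularModulus_exists_iff_forall` : `∃ k`-typings by a singular modulus are DETERMINATE — by
  existence and uniqueness of the `N`-th singular modulus (`existsUnique_singularModulus`,
  `EllipticKBasic.lean`), `(∃ k, 0<k<1 ∧ K′(k) = √N K(k) ∧ P k) ↔ (∀ k, 0<k<1 → K′(k) = √N K(k) → P k)`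
  for every predicate `P`; `pearsonDensityFourAtOne_eq_K15_of_thm9` : the `K₁₅` form of `p₄(1)`
  follows from Theorem 9 plus the [bz92] evaluation of `K₁₅` (both inputs Chowla–Selberg-deep,
  neither in Mathlib, both explicit hypotheses); and conversely
  `ellipticK_sq_of_thm9_of_pearsonDensityFourAtOne_eq_K15` : Theorem 9 and the `K₁₅` form together
  pin `K(k)² = (1 + √5) Γ(1/15)Γ(2/15)Γ(4/15)Γ(8/15) / (240 π)` at every such modulus.
* `integrableOn_mul_besselJ_zero_pow_five`, `tendsto_intervalIntegral_pearsonDensityFourAtOne`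
  (with `continuous_mul_besselJ_zero_pow_five`): Kluyver's integrand `t J₀(t)⁵` is integrable on
  `(0, ∞)` (`|J₀| ≤ 1` near `0`, `|J₀(t)| ≤ C t^{-1/2}` for `t ≥ 1` from `BesselJProofs.lean`, so
  the integrand is `O(t^{-3/2})`), hence `pearsonDensityFourAtOne = lim_{R→∞} ∫₀ᴿ t J₀(t)⁵ dt` is
  the printed improper integral and not a junk value. These three statements were first landed
  by proposal p47122 (seat `…Borwe-6df1bba746-0`, fact `BorweinStraubWanZudilin2012_thm9`) and
  inadvertently dropped by the whole-file proposal p47272; they are restored here with the same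
  names and statements (proofs rewritten).

## References

* [BorweinEtAl2012] J. M. Borwein, A. Straub, J. Wan, W. Zudilin, Densities of short uniform random
  walks, Canad. J. Math. 64 (2012) 961–990 (arXiv:1103.2995), §5 Thm 9, eqs. (5.2)–(5.3).
* [bz92] J. M. Borwein, I. J. Zucker, Fast evaluation of the gamma function for small rational
  fractions using complete elliptic integrals of the first kind, IMA J. Numer. Anal. 12 (1992)
  519–526 (the `K₁₅` entry).
-/

noncomputable section

open _root_.Real _root_.MeasureTheory _root_.Set

namespace Literature.Analysis.FunctionSpaces

/-! ### Theorem 9 ⟺ (5.2)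

The reflection-formula step "(eq:r50cs) may be simplified to (5.2)" of the source is proved
upstream, in `UniformRandomWalkDensity.lean` itself (p47005: `prod_sin_pi_div_fifteen`,
`prod_Gamma_fifteenths`, `BorweinStraubWanZudilin2012_thm9_rhs_eq_eq_5_2_rhs`,
`BorweinStraubWanZudilin2012_thm9_iff_eq_5_2`). The verbatim duplicates of the first three that
this companion carried (p47122: `sin_pi_div_fifteen_mul_prod`, `Gamma_fifteenths_prod_mul_prod`,
`BorweinStraubWanZudilin2012_thm9_rhs_eq`, same normalized statements, unused outside this file)
are removed in favour of the upstream theorems; only the `↔` in the direction used below is kept,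
with eq. (5.2) written out as an explicit equation about `pearsonDensityFourAtOne` (review-split
2026-08-15: (5.2), being proved equivalent to Theorem 9, is not a separate named fact — the one
named fact for the closed form of `p₄(1)` is `BorweinStraubWanZudilin2012_thm9`).
-/

/-- **Eq. (5.2) and Theorem 9 of the source are equivalent statements about `p₄(1)`**:
`p₄(1) = (√5/40)·Γ(1/15)Γ(2/15)Γ(4/15)Γ(8/15)/π⁴ ↔ p₄(1) = (1/(2π²))√(G/(5H))`, because the two
right-hand sides are the same real number (`BorweinStraubWanZudilin2012_thm9_rhs_eq_eq_5_2_rhs`,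
the "[bz92] simplification": reflection formula at fifteenths). Eq. (5.2) is written out
explicitly; the only named fact involved is `BorweinStraubWanZudilin2012_thm9`.
[cite: BorweinEtAl2012, §5 Thm 9, eq. (5.2)] -/
theorem BorweinStraubWanZudilin2012_eq_5_2_iff_thm9 :
    pearsonDensityFourAtOne =
        Real.sqrt 5 / 40 *
          (Real.Gamma (1 / 15) * Real.Gamma (2 / 15) * Real.Gamma (4 / 15) * Real.Gamma (8 / 15)) /
            π ^ 4 ↔
      BorweinStraubWanZudilin2012_thm9 := by
  unfold BorweinStraubWanZudilin2012_thm9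
  rw [BorweinStraubWanZudilin2012_thm9_rhs_eq_eq_5_2_rhs]

/-- **What separates (5.2) from the `K₁₅` form (5.3)**: given eq. (5.2), the printed `K₁₅` form
of `p₄(1)` (with the 15th singular modulus typed by `0 < k < 1`, `K′(k) = √15 K(k)`) holds iff
there is a modulus `0 < k < 1` at which `K′ = √15 K` and
`K(k)² = (1 + √5) Γ(1/15)Γ(2/15)Γ(4/15)Γ(8/15) / (240 π)` — the Borwein–Zucker evaluation of
`K₁₅` used by the source ("Using [bz92]"). Pure algebra:
`(√5/40) G/π⁴ = (3√5/π³)·((√5-1)/2)·K²  ⟺  K² = (1+√5) G/(240π)`. Stated for the explicit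
printed reading, independently of the cut of the named fact `BorweinStraubWanZudilin2012_eq_5_3`;
the hypothesis is eq. (5.2) written out (`p₄(1) = (√5/40)G/π⁴`; from Theorem 9 by
`BorweinStraubWanZudilin2012_eq_5_2_iff_thm9`). [cite: BorweinEtAl2012, §5 eqs. (5.2)–(5.3)] -/
theorem pearsonDensityFourAtOne_eq_K15_iff_of_eq_5_2
    (h : pearsonDensityFourAtOne =
      Real.sqrt 5 / 40 *
        (Real.Gamma (1 / 15) * Real.Gamma (2 / 15) * Real.Gamma (4 / 15) * Real.Gamma (8 / 15)) /
          π ^ 4) :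
    (∃ k : ℝ, 0 < k ∧ k < 1 ∧
        Literature.Probability.RandomPlanarGeometry.ellipticK (1 - k ^ 2) =
          Real.sqrt 15 * Literature.Probability.RandomPlanarGeometry.ellipticK (k ^ 2) ∧
        pearsonDensityFourAtOne =
          3 * Real.sqrt 5 / π ^ 3 * ((Real.sqrt 5 - 1) / 2) *
            Literature.Probability.RandomPlanarGeometry.ellipticK (k ^ 2) ^ 2) ↔
      ∃ k : ℝ, 0 < k ∧ k < 1 ∧
        Literature.Probability.RandomPlanarGeometry.ellipticK (1 - k ^ 2) =
          Real.sqrt 15 * Literature.Probability.RandomPlanarGeometry.ellipticK (k ^ 2) ∧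
        Literature.Probability.RandomPlanarGeometry.ellipticK (k ^ 2) ^ 2 =
          (1 + Real.sqrt 5) *
            (Real.Gamma (1 / 15) * Real.Gamma (2 / 15) * Real.Gamma (4 / 15) * Real.Gamma (8 / 15)) /
            (240 * π) := by
  rw [h]
  set G := Real.Gamma (1 / 15) * Real.Gamma (2 / 15) * Real.Gamma (4 / 15) * Real.Gamma (8 / 15)
    with hG
  have h5 : Real.sqrt 5 ^ 2 = 5 := Real.sq_sqrt (by norm_num)
  have h5pos : 0 < Real.sqrt 5 := Real.sqrt_pos.mpr (by norm_num)
  have h51 : 0 < Real.sqrt 5 - 1 := by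
    have : (1:ℝ) < Real.sqrt 5 := by
      rw [show (1:ℝ) = Real.sqrt 1 by simp]
      exact Real.sqrt_lt_sqrt (by norm_num) (by norm_num)
    linarith
  have hpi := Real.pi_pos
  refine exists_congr fun k => ?_
  refine and_congr_right fun _ => and_congr_right fun _ => and_congr_right fun _ => ?_
  set K := Literature.Probability.RandomPlanarGeometry.ellipticK (k ^ 2)
  constructor
  · intro hK
    -- √5/40 · G/π⁴ = 3√5/π³ · (√5-1)/2 · K²  ⟹  K² = (1+√5) G /(240 π)
    rw [eq_div_iff (by positivity)]
    rw [div_eq_iff (by positivity)] at hK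
    -- hK : √5/40 * G = 3√5/π³ * ((√5-1)/2) * K² * π⁴ ; cancel √5/40: G = 60 (√5-1) K² π
    have hK'' : G = 60 * (Real.sqrt 5 - 1) * K ^ 2 * π := by
      have hne : Real.sqrt 5 / 40 ≠ 0 := by positivity
      have hπ : π ≠ 0 := Real.pi_pos.ne'
      apply mul_left_cancel₀ hne
      rw [hK]
      field_simp
      ring
    rw [hK'']
    linear_combination (-(60:ℝ) * K ^ 2 * π) * h5
  · intro hK
    rw [eq_div_iff (by positivity)] at hK
    rw [div_eq_iff (by positivity)]
    -- goal: √5/40 * G = 3√5/π³ * ((√5-1)/2) * K² * π⁴ ; from hK : K² (240 π) = (1+√5) G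
    have hG' : G = 60 * (Real.sqrt 5 - 1) * K ^ 2 * π := by
      have h4 : (1 + Real.sqrt 5) * (Real.sqrt 5 - 1) = 4 := by linear_combination h5
      have hne : (1 + Real.sqrt 5) ≠ 0 := by positivity
      apply mul_left_cancel₀ hne
      linear_combination (-(1:ℝ)) * hK + (-(60:ℝ) * K ^ 2 * π) * h4
    rw [hG']
    field_simp
    ring

/-! ### Kluyver's integrand `t J₀(t)⁵` is integrable on `(0, ∞)` (restored from p47122) -/

/-- `t ↦ t J₀(t)⁵` is continuous. [folklore] -/
theorem continuous_mul_besselJ_zero_pow_five : Continuous fun t : ℝ => t * besselJ 0 t ^ 5 :=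
  continuous_id.mul ((continuous_besselJ_holds 0).pow 5)

/-- **Kluyver's integrand for `p₄(1)` is integrable on `(0, ∞)`**: on `(0, 1]` it is continuous
on a compact interval, and for `t ≥ 1`, `|t J₀(t)⁵| ≤ |C|⁵ t^{-3/2}` by the decay bound
`|J₀(t)| ≤ C t^{-1/2}` (`abs_besselJ_le_mul_rpow_neg_half`, the leading order of the Hankel
expansion). Hence the Bochner integral defining `pearsonDensityFourAtOne` is a genuine value.
[cite: BorweinEtAl2012, §2 eq. (2.1)] -/
theorem integrableOn_mul_besselJ_zero_pow_five :
    IntegrableOn (fun t : ℝ => t * besselJ 0 t ^ 5) (Ioi 0) := by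
  obtain ⟨C, hC⟩ := abs_besselJ_le_mul_rpow_neg_half 0
  rw [← Ioc_union_Ioi_eq_Ioi zero_le_one]
  refine IntegrableOn.union ?_ ?_
  · exact (continuous_mul_besselJ_zero_pow_five.continuousOn.integrableOn_compact
      isCompact_Icc).mono_set Ioc_subset_Icc_self
  · have hint : IntegrableOn (fun t : ℝ => |C| ^ 5 * t ^ (-(3 / 2 : ℝ))) (Ioi 1) :=
      (integrableOn_Ioi_rpow_of_lt (by norm_num : (-(3 / 2 : ℝ)) < -1) zero_lt_one).const_mul _
    refine hint.mono' continuous_mul_besselJ_zero_pow_five.aestronglyMeasurable ?_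
    refine (ae_restrict_mem measurableSet_Ioi).mono fun t ht => ?_
    have ht1 : (1 : ℝ) < t := ht
    have ht0 : 0 < t := lt_trans zero_lt_one ht1
    have hJ : |besselJ 0 t| ≤ |C| * t ^ (-(1 / 2 : ℝ)) :=
      (hC t (by rw [Nat.cast_zero, zero_add]; exact ht1.le)).trans
        (mul_le_mul_of_nonneg_right (le_abs_self C) (Real.rpow_nonneg ht0.le _))
    have hpow : |besselJ 0 t| ^ 5 ≤ (|C| * t ^ (-(1 / 2 : ℝ))) ^ 5 :=
      pow_le_pow_left₀ (abs_nonneg _) hJ 5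
    have e1 : (t ^ (-(1 / 2 : ℝ))) ^ (5 : ℕ) = t ^ (-(5 / 2 : ℝ)) := by
      rw [← Real.rpow_natCast, ← Real.rpow_mul ht0.le]
      norm_num
    have e2 : t * t ^ (-(5 / 2 : ℝ)) = t ^ (-(3 / 2 : ℝ)) := by
      rw [show (-(3 / 2 : ℝ)) = 1 + -(5 / 2 : ℝ) by norm_num, Real.rpow_add ht0, Real.rpow_one]
    rw [Real.norm_eq_abs, abs_mul, abs_of_pos ht0, abs_pow]
    calc t * |besselJ 0 t| ^ 5 ≤ t * (|C| * t ^ (-(1 / 2 : ℝ))) ^ 5 :=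
          mul_le_mul_of_nonneg_left hpow ht0.le
      _ = |C| ^ 5 * t ^ (-(3 / 2 : ℝ)) := by rw [mul_pow, e1, ← e2]; ring

/-- **`pearsonDensityFourAtOne` is the improper integral `lim_{R → ∞} ∫₀ᴿ t J₀(t)⁵ dt`** printed
in the source (Kluyver's (2.1) at `n = 4`, `x = 1`). [cite: BorweinEtAl2012, §2 eq. (2.1)] -/
theorem tendsto_intervalIntegral_pearsonDensityFourAtOne :
    Filter.Tendsto (fun R : ℝ => ∫ t in (0 : ℝ)..R, t * besselJ 0 t ^ 5) Filter.atTop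
      (nhds pearsonDensityFourAtOne) :=
  MeasureTheory.intervalIntegral_tendsto_integral_Ioi 0 integrableOn_mul_besselJ_zero_pow_five
    Filter.tendsto_id

/-! ### The `K₁₅` form is determinate, and reduces to Theorem 9 plus the [bz92] value of `K₁₅`

The printed `K₁₅` form of `p₄(1)` types the 15th singular value with an existential
(`∃ k, 0 < k < 1, K′(k) = √15 K(k) ∧ …`). Since exactly one such modulus exists
(`Literature.Probability.RandomPlanarGeometry.existsUnique_singularModulus`), the existential and
the universal readings coincide (`singularModulus_exists_iff_forall`, for any predicate and any
`N > 0`), so the statement says precisely "`p₄(1) = (3√5/π³)((√5-1)/2) K₁₅²` for THE 15th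
singular value `K₁₅`", as printed. What separates it from a proof is recorded as two implications
with explicit inputs and nothing else: Theorem 9 of the source (the tree fact
`BorweinStraubWanZudilin2012_thm9`: modular parametrisation (4.15) of `p₄` + Chowla–Selberg) and
the Borwein–Zucker / Borwein–Borwein evaluation `K₁₅² = (1+√5) Γ(1/15)Γ(2/15)Γ(4/15)Γ(8/15)/(240π)`
("Using [bz92]" in the source; Chowla–Selberg for discriminant `-15`), which is NOT introduced as
a new named fact here (D-0026) — it only ever appears as an explicit hypothesis or conclusion.
Numerically (AGM, double precision): `k₁₅ ≈ 0.0091190063`, `K₁₅ ≈ 1.5708289837`,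
`K₁₅² ≈ 2.4675036961 ≈ (1+√5)·G/(240π)`, and all three printed right-hand sides (Thm 9, (5.2),
(5.3)) evaluate to `0.32993380106006…`, the value of `p₄(1)` printed in §5 of the source.
-/

/-- **Singular-modulus typings are determinate**: because the `N`-th singular modulus exists and
is unique (`existsUnique_singularModulus`), for every predicate `P` the `∃ k` reading
"some modulus `0 < k < 1` with `K′(k) = √N K(k)` satisfies `P`" is equivalent to the `∀ k`
reading "every such modulus satisfies `P`". [folklore] -/
theorem singularModulus_exists_iff_forall {N : ℝ} (hN : 0 < N) (P : ℝ → Prop) :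
    (∃ k : ℝ, 0 < k ∧ k < 1 ∧
        Literature.Probability.RandomPlanarGeometry.ellipticK (1 - k ^ 2) =
          Real.sqrt N * Literature.Probability.RandomPlanarGeometry.ellipticK (k ^ 2) ∧ P k) ↔
      ∀ k : ℝ, 0 < k → k < 1 →
        Literature.Probability.RandomPlanarGeometry.ellipticK (1 - k ^ 2) =
          Real.sqrt N * Literature.Probability.RandomPlanarGeometry.ellipticK (k ^ 2) → P k := by
  obtain ⟨k₀, ⟨hk₀0, hk₀1, hk₀⟩, huniq⟩ :=
    Literature.Probability.RandomPlanarGeometry.existsUnique_singularModulus hN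
  constructor
  · rintro ⟨k, hk0, hk1, hk, hP⟩ k' hk0' hk1' hk'
    have e1 : k = k₀ := huniq k ⟨hk0, hk1, hk⟩
    have e2 : k' = k₀ := huniq k' ⟨hk0', hk1', hk'⟩
    rw [e2, ← e1]
    exact hP
  · intro h
    exact ⟨k₀, hk₀0, hk₀1, hk₀, h k₀ hk₀0 hk₀1 hk₀⟩

/-- **The `K₁₅` form of `p₄(1)` is determinate**: its `∃ k` typing is equivalent to the `∀ k`
reading — for every modulus `0 < k < 1` with `K′(k) = √15 K(k)`,
`p₄(1) = (3√5/π³)((√5-1)/2) K(k)²`. [cite: BorweinEtAl2012, §5 eq. (5.3)] -/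
theorem pearsonDensityFourAtOne_eq_K15_iff_forall :
    (∃ k : ℝ, 0 < k ∧ k < 1 ∧
        Literature.Probability.RandomPlanarGeometry.ellipticK (1 - k ^ 2) =
          Real.sqrt 15 * Literature.Probability.RandomPlanarGeometry.ellipticK (k ^ 2) ∧
        pearsonDensityFourAtOne =
          3 * Real.sqrt 5 / π ^ 3 * ((Real.sqrt 5 - 1) / 2) *
            Literature.Probability.RandomPlanarGeometry.ellipticK (k ^ 2) ^ 2) ↔
      ∀ k : ℝ, 0 < k → k < 1 →
        Literature.Probability.RandomPlanarGeometry.ellipticK (1 - k ^ 2) =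
          Real.sqrt 15 * Literature.Probability.RandomPlanarGeometry.ellipticK (k ^ 2) →
        pearsonDensityFourAtOne =
          3 * Real.sqrt 5 / π ^ 3 * ((Real.sqrt 5 - 1) / 2) *
            Literature.Probability.RandomPlanarGeometry.ellipticK (k ^ 2) ^ 2 :=
  singularModulus_exists_iff_forall (show (0 : ℝ) < 15 by norm_num) _

/-- **The `K₁₅` form of `p₄(1)` from Theorem 9 and the [bz92] value of `K₁₅`** — the exact
residual obligation of the printed chain (5.2)–(5.3): it follows from the source's Theorem 9
(`BorweinStraubWanZudilin2012_thm9`, via `BorweinStraubWanZudilin2012_eq_5_2_iff_thm9`) together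
with the existence of a modulus `0 < k < 1`, `K′(k) = √15 K(k)`, at which
`K(k)² = (1 + √5) Γ(1/15)Γ(2/15)Γ(4/15)Γ(8/15) / (240 π)` (Borwein–Zucker 1992 / Borwein–Borwein,
*Pi and the AGM*, the 15th singular value; the step "Using [bz92]" of the source). Both inputs are
explicit hypotheses; neither is asserted. [cite: BorweinEtAl2012, §5 Thm 9, eqs. (5.2)–(5.3)] -/
theorem pearsonDensityFourAtOne_eq_K15_of_thm9 (h9 : BorweinStraubWanZudilin2012_thm9)
    (hK : ∃ k : ℝ, 0 < k ∧ k < 1 ∧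
      Literature.Probability.RandomPlanarGeometry.ellipticK (1 - k ^ 2) =
        Real.sqrt 15 * Literature.Probability.RandomPlanarGeometry.ellipticK (k ^ 2) ∧
      Literature.Probability.RandomPlanarGeometry.ellipticK (k ^ 2) ^ 2 =
        (1 + Real.sqrt 5) *
          (Real.Gamma (1 / 15) * Real.Gamma (2 / 15) * Real.Gamma (4 / 15) * Real.Gamma (8 / 15)) /
          (240 * π)) :
    ∃ k : ℝ, 0 < k ∧ k < 1 ∧
      Literature.Probability.RandomPlanarGeometry.ellipticK (1 - k ^ 2) =
        Real.sqrt 15 * Literature.Probability.RandomPlanarGeometry.ellipticK (k ^ 2) ∧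
      pearsonDensityFourAtOne =
        3 * Real.sqrt 5 / π ^ 3 * ((Real.sqrt 5 - 1) / 2) *
          Literature.Probability.RandomPlanarGeometry.ellipticK (k ^ 2) ^ 2 :=
  (pearsonDensityFourAtOne_eq_K15_iff_of_eq_5_2
    (BorweinStraubWanZudilin2012_eq_5_2_iff_thm9.2 h9)).2 hK

/-- **Conversely, Theorem 9 and the `K₁₅` form together pin the value of `K₁₅`**: if both printed
forms hold then at every modulus `0 < k < 1` with `K′(k) = √15 K(k)` (there is exactly one),
`K(k)² = (1 + √5) Γ(1/15)Γ(2/15)Γ(4/15)Γ(8/15) / (240 π)` — the Borwein–Zucker evaluation the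
source invokes between (5.2) and (5.3). [cite: BorweinEtAl2012, §5 eqs. (5.2)–(5.3)] -/
theorem ellipticK_sq_of_thm9_of_pearsonDensityFourAtOne_eq_K15
    (h9 : BorweinStraubWanZudilin2012_thm9)
    (h3 : ∃ k : ℝ, 0 < k ∧ k < 1 ∧
      Literature.Probability.RandomPlanarGeometry.ellipticK (1 - k ^ 2) =
        Real.sqrt 15 * Literature.Probability.RandomPlanarGeometry.ellipticK (k ^ 2) ∧
      pearsonDensityFourAtOne =
        3 * Real.sqrt 5 / π ^ 3 * ((Real.sqrt 5 - 1) / 2) *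
          Literature.Probability.RandomPlanarGeometry.ellipticK (k ^ 2) ^ 2) :
    ∀ k : ℝ, 0 < k → k < 1 →
      Literature.Probability.RandomPlanarGeometry.ellipticK (1 - k ^ 2) =
        Real.sqrt 15 * Literature.Probability.RandomPlanarGeometry.ellipticK (k ^ 2) →
      Literature.Probability.RandomPlanarGeometry.ellipticK (k ^ 2) ^ 2 =
        (1 + Real.sqrt 5) *
          (Real.Gamma (1 / 15) * Real.Gamma (2 / 15) * Real.Gamma (4 / 15) * Real.Gamma (8 / 15)) /
          (240 * π) :=
  (singularModulus_exists_iff_forall (show (0 : ℝ) < 15 by norm_num) _).1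
    ((pearsonDensityFourAtOne_eq_K15_iff_of_eq_5_2
      (BorweinStraubWanZudilin2012_eq_5_2_iff_thm9.2 h9)).1 h3)

end Literature.Analysis.FunctionSpaces

end
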